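import Literature.MathematicalPhysics.QuantumFieldTheory.Balaban1983to89.B9Eq311L2Pairing

/-!
# `Balaban1983to89.B9Eq347SupRowToL2Symmetric` — T. Bałaban, *Propagators for lattice gauge theories in a background field*, Commun. Math. Phys. **99** (1985) 389–434
# [Balaban1985BackgroundPropagators] (3.47) p. 398 («consequences of (3.42) and Lemma 2.1 [4]») ∕ (3.49) p. 399 («These theorems imply all the properties of the operator R … we will need»),
# Thm 3.11 p. 416 (the operators are symmetric ∕ positive): **A SYMMETRIC OPERATOR OF THE CHAIN's WEIGHTED `L²` CARRIER IS BOUNDED IN `L²` BY ITS `ℓ^∞ → ℓ^∞` LETTER, WITHOUT VOLUME** —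
# `‖Tf‖_{L²(w)} ≤ C·‖f‖_{L²(w)}` whenever `T` is symmetric and `sup_x‖(Tf)(x)‖ ≤ C·sup_x‖f(x)‖` for every `f`: the power trick `‖Tf‖^{2^k} ≤ ‖T^{2^k}f‖·‖f‖^{2^k−1}` kills the (volume-dependent)
# norm-comparison constant — the bridge from this lineage's lattice-free `ℓ^∞` letters (`B9Thm34TowerVacuumLadderRows`, `B9Eq349TowerCoarseRowsOfMajorant`: `G′_k(U) − G′_k(1)`, `c_k(U) − c_k(1)`,
# `R_k(U) − R_k(1)`, all symmetric) to LATTICE-FREE `L²` operator bounds (the currency of the OWNER's road and of `Support/NE9CurChartLipschitzAtFlat`)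

statement-level skeleton of published theorems with citation tags; proofs where landed; nothing here is a claim about the Yang–Mills mass gap

CITATION HEADER (lean-in-tree rule).  Audit cell `pub-balaban`, sub-cell `t4`, BINDER row NE9; NE9 crux-team LEAF PROVER 01 (`b2b-balaban-t4-ne9-formalise-leaf-01`,
gen 99; bears_on: R4/N22).  Vocabulary BY NAME: the chain's `B9Eq311L2Pairing.WL2` ∕ `WL2.equiv` ∕ `WL2.norm_sq` ∕ `WL2.weight_mul_norm_sq_apply_le`, Mathlib's `LinearMap.IsSymmetric`,
`pow_unbounded_of_one_lt`.  Sources: [Balaban1985BackgroundPropagators] pp. 398–399, 416 (loci only).  [folklore] spectral-radius∕power trick (`‖T‖_{2→2} = ρ(T) ≤ ‖T‖_{∞→∞}` for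
symmetric `T`); NOTHING of print's proofs is reproduced.

WHAT IS PROVED (sorry-free; proof lane — no `def`).
* **`isSymmetric_mul_self`**, **`norm_sq_le_norm_mul_self_mul`** (`‖Ag‖² ≤ ‖A²g‖·‖g‖` for symmetric `A`), **`sup_le_of_norm`** ∕ **`norm_le_of_sup`** (the two norm comparisons on the
  finite weighted carrier, constants `Σ_x(√w(x))⁻¹` and `√(Σ_x w(x))`), and the main **`norm_le_of_isSymmetric_of_supRow`**.
HONEST SCOPE.  Functional-analysis bookkeeping on the finite carrier; no estimate of the paper; NE9 NOT PRINTED ∕ NOT PROVED; spine PROVED 0∕9; rung (B)+1 finite T⁴ — NOT infinite volume, NOT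
mass gap, NOT BetaPertH, NOT Clay.  HONEST DEPENDENCY: continuum YM on T⁴ ⇐ BetaPertH ∧ nine spine estimates (0/9 proved); BetaPertH ⇐ (D1) ∧ (D4) ∧ CAP+tail; G-an2-4 gates asym, D1
and NE2/3/4.  NEW file; nothing modified.  Net new unproved facts: 0.
-/

noncomputable section

open scoped BigOperators InnerProductSpace

namespace Literature.MathematicalPhysics.QuantumFieldTheory.Balaban1983to89.B9Eq347SupRowToL2Symmetric

open B9Eq311L2Pairing (WL2)

variable {𝕜 : Type*} [RCLike 𝕜] {X : Type*} [Fintype X] {V : Type*} [NormedAddCommGroup V] [InnerProductSpace 𝕜 V] {w : X → ℝ} [Fact (∀ x, 0 < w x)]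

/-- The square of a symmetric operator is symmetric. [folklore] [cite: Balaban1985BackgroundPropagators, Thm 3.11 p.416] -/
theorem isSymmetric_mul_self {E : Type*} [NormedAddCommGroup E] [InnerProductSpace 𝕜 E] {A : E →ₗ[𝕜] E} (hA : A.IsSymmetric) : (A * A).IsSymmetric :=
  fun x y => by rw [Module.End.mul_apply, Module.End.mul_apply, hA, hA]

/-- `‖Ag‖² ≤ ‖A²g‖·‖g‖` for a symmetric `A` (`‖Ag‖² = re⟨A²g, g⟩`). [folklore] [cite: Balaban1985BackgroundPropagators, Thm 3.11 p.416] -/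
theorem norm_sq_le_norm_mul_self_mul {E : Type*} [NormedAddCommGroup E] [InnerProductSpace 𝕜 E] {A : E →ₗ[𝕜] E} (hA : A.IsSymmetric) (g : E) :
    ‖A g‖ ^ 2 ≤ ‖(A * A) g‖ * ‖g‖ := by
  have h1 : (‖A g‖ ^ 2 : ℝ) = RCLike.re ⟪(A * A) g, g⟫_𝕜 := by
    rw [Module.End.mul_apply, hA, ← @inner_self_eq_norm_sq 𝕜]
  rw [h1]
  exact (RCLike.re_le_norm _).trans (norm_inner_le_norm _ _)

/-- **SUP ≤ CONSTANT·L²** on the finite weighted carrier: `‖f(x)‖ ≤ (Σ_{x′}(√w(x′))⁻¹)·‖f‖`. [folklore] [cite: Balaban1985BackgroundPropagators, (3.11) p.392] -/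
theorem sup_le_of_norm (f : WL2 𝕜 w V) (x : X) : ‖WL2.equiv 𝕜 w V f x‖ ≤ (∑ x' : X, (Real.sqrt (w x'))⁻¹) * ‖f‖ := by
  have hw : ∀ x, 0 < w x := Fact.out
  have hs : 0 < Real.sqrt (w x) := Real.sqrt_pos.mpr (hw x)
  have h2 : (Real.sqrt (w x) * ‖WL2.equiv 𝕜 w V f x‖) ^ 2 ≤ ‖f‖ ^ 2 := by
    rw [mul_pow, Real.sq_sqrt (hw x).le]; exact WL2.weight_mul_norm_sq_apply_le (𝕜 := 𝕜) f x
  have h3 : Real.sqrt (w x) * ‖WL2.equiv 𝕜 w V f x‖ ≤ ‖f‖ := le_of_pow_le_pow_left₀ two_ne_zero (norm_nonneg f) h2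
  have h1 : ‖WL2.equiv 𝕜 w V f x‖ ≤ (Real.sqrt (w x))⁻¹ * ‖f‖ := by
    rw [le_inv_mul_iff₀ hs]; exact h3
  refine h1.trans (mul_le_mul_of_nonneg_right ?_ (norm_nonneg f))
  exact Finset.single_le_sum (f := fun x' => (Real.sqrt (w x'))⁻¹) (fun x' _ => inv_nonneg.mpr (Real.sqrt_nonneg _)) (Finset.mem_univ x)

/-- **L² ≤ CONSTANT·SUP** on the finite weighted carrier: `‖g‖ ≤ √(Σ_x w(x))·s` when `‖g(x)‖ ≤ s` for all `x`. [folklore] [cite: Balaban1985BackgroundPropagators, (3.11) p.392] -/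
theorem norm_le_of_sup (g : WL2 𝕜 w V) {s : ℝ} (hs : 0 ≤ s) (hg : ∀ x, ‖WL2.equiv 𝕜 w V g x‖ ≤ s) : ‖g‖ ≤ Real.sqrt (∑ x : X, w x) * s := by
  have hw : ∀ x, 0 < w x := Fact.out
  have hsum : 0 ≤ ∑ x : X, w x := Finset.sum_nonneg fun x _ => (hw x).le
  have h1 : ‖g‖ ^ 2 ≤ (Real.sqrt (∑ x : X, w x) * s) ^ 2 := by
    rw [WL2.norm_sq, mul_pow, Real.sq_sqrt hsum, Finset.sum_mul]
    exact Finset.sum_le_sum fun x _ => mul_le_mul_of_nonneg_left (pow_le_pow_left₀ (norm_nonneg _) (hg x) 2) (hw x).le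
  exact le_of_pow_le_pow_left₀ two_ne_zero (mul_nonneg (Real.sqrt_nonneg _) hs) h1

/-- **A SYMMETRIC OPERATOR IS BOUNDED IN `L²` BY ITS `ℓ^∞ → ℓ^∞` LETTER, WITHOUT VOLUME**: if `T` is symmetric on the weighted carrier and `sup_x‖(Tf)(x)‖ ≤ C·F` whenever `sup_x‖f(x)‖ ≤ F`,
then `‖Tf‖ ≤ C·‖f‖` — the norm-comparison constant `√(Σw)·Σ(√w)⁻¹` (the volume) is killed by the power trick `‖Tf‖^{2^k} ≤ ‖T^{2^k}f‖·‖f‖^{2^k−1}`.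
[cite: Balaban1985BackgroundPropagators, (3.47) p.398, (3.49) p.399, Thm 3.11 p.416] -/
theorem norm_le_of_isSymmetric_of_supRow (T : WL2 𝕜 w V →ₗ[𝕜] WL2 𝕜 w V) (hT : T.IsSymmetric) {C : ℝ} (hC : 0 ≤ C)
    (hsup : ∀ (f : WL2 𝕜 w V) (F : ℝ), (∀ x, ‖WL2.equiv 𝕜 w V f x‖ ≤ F) → ∀ x, ‖WL2.equiv 𝕜 w V (T f) x‖ ≤ C * F)
    (f : WL2 𝕜 w V) : ‖T f‖ ≤ C * ‖f‖ := by
  -- the volume-dependent comparison constant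
  set D : ℝ := Real.sqrt (∑ x : X, w x) * ∑ x' : X, (Real.sqrt (w x'))⁻¹ with hD
  have hB0 : 0 ≤ ∑ x' : X, (Real.sqrt (w x'))⁻¹ := Finset.sum_nonneg fun x' _ => inv_nonneg.mpr (Real.sqrt_nonneg _)
  have hD0 : 0 ≤ D := mul_nonneg (Real.sqrt_nonneg _) hB0
  -- the squaring tower `S 0 = T`, `S (k+1) = S k ∘ S k`
  let S : ℕ → (WL2 𝕜 w V →ₗ[𝕜] WL2 𝕜 w V) := fun k => Nat.rec T (fun _ A => A * A) k
  have hS0 : S 0 = T := rfl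
  have hSs : ∀ k, S (k + 1) = S k * S k := fun k => rfl
  have hsym : ∀ k, (S k).IsSymmetric := by
    intro k
    induction k with
    | zero => exact hT
    | succ k ih => rw [hSs]; exact isSymmetric_mul_self ih
  have hsupk : ∀ (k : ℕ) (g : WL2 𝕜 w V) (F : ℝ), (∀ x, ‖WL2.equiv 𝕜 w V g x‖ ≤ F) → ∀ x, ‖WL2.equiv 𝕜 w V (S k g) x‖ ≤ C ^ (2 ^ k) * F := by
    intro k
    induction k with
    | zero => intro g F hg x; rw [hS0, pow_zero, pow_one]; exact hsup g F hg x
    | succ k ih =>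
      intro g F hg x
      rw [hSs, Module.End.mul_apply, pow_succ, pow_mul, sq, mul_assoc]
      exact ih (S k g) (C ^ (2 ^ k) * F) (ih g F hg) x
  -- `‖S k f‖ ≤ D·C^{2^k}·‖f‖`
  have hnormk : ∀ k, ‖S k f‖ ≤ D * (C ^ (2 ^ k) * ‖f‖) := by
    intro k
    have hs : ∀ x, ‖WL2.equiv 𝕜 w V (S k f) x‖ ≤ C ^ (2 ^ k) * ((∑ x' : X, (Real.sqrt (w x'))⁻¹) * ‖f‖) :=
      hsupk k f _ (fun x => sup_le_of_norm f x)
    refine (norm_le_of_sup (S k f) (by positivity) hs).trans (le_of_eq ?_)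
    rw [hD]; ring
  -- the power trick `‖Tf‖^{2^k} ≤ ‖S k f‖·‖f‖^{2^k − 1}`
  have hchain : ∀ k, ‖T f‖ ^ (2 ^ k) ≤ ‖S k f‖ * ‖f‖ ^ (2 ^ k - 1) := by
    intro k
    induction k with
    | zero => rw [hS0]; simp
    | succ k ih =>
      have h1 : ‖T f‖ ^ (2 ^ (k + 1)) = (‖T f‖ ^ (2 ^ k)) ^ 2 := by rw [pow_succ, pow_mul]
      have h2 : (‖S k f‖ * ‖f‖ ^ (2 ^ k - 1)) ^ 2 = ‖S k f‖ ^ 2 * ‖f‖ ^ (2 * (2 ^ k - 1)) := by rw [mul_pow, ← pow_mul, mul_comm (2 ^ k - 1)]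
      have h3 : ‖S k f‖ ^ 2 ≤ ‖S (k + 1) f‖ * ‖f‖ := by rw [hSs]; exact norm_sq_le_norm_mul_self_mul (hsym k) f
      have hexp : 2 ^ (k + 1) - 1 = 1 + 2 * (2 ^ k - 1) := by
        have := Nat.one_le_two_pow (n := k); rw [pow_succ]; omega
      calc ‖T f‖ ^ (2 ^ (k + 1)) = (‖T f‖ ^ (2 ^ k)) ^ 2 := h1
        _ ≤ (‖S k f‖ * ‖f‖ ^ (2 ^ k - 1)) ^ 2 := pow_le_pow_left₀ (by positivity) ih 2
        _ = ‖S k f‖ ^ 2 * ‖f‖ ^ (2 * (2 ^ k - 1)) := h2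
        _ ≤ ‖S (k + 1) f‖ * ‖f‖ * ‖f‖ ^ (2 * (2 ^ k - 1)) := mul_le_mul_of_nonneg_right h3 (by positivity)
        _ = ‖S (k + 1) f‖ * ‖f‖ ^ (2 ^ (k + 1) - 1) := by rw [hexp, pow_add, pow_one]; ring
  -- `‖Tf‖^{2^k} ≤ D·(C‖f‖)^{2^k}` for every `k`
  have hpow : ∀ k, ‖T f‖ ^ (2 ^ k) ≤ D * (C * ‖f‖) ^ (2 ^ k) := by
    intro k
    have h1 := (hchain k).trans (mul_le_mul_of_nonneg_right (hnormk k) (by positivity))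
    have hexp : ‖f‖ * ‖f‖ ^ (2 ^ k - 1) = ‖f‖ ^ (2 ^ k) := by
      rw [← pow_succ']; congr 1; have := Nat.one_le_two_pow (n := k); omega
    calc ‖T f‖ ^ (2 ^ k) ≤ D * (C ^ (2 ^ k) * ‖f‖) * ‖f‖ ^ (2 ^ k - 1) := h1
      _ = D * (C ^ (2 ^ k) * (‖f‖ * ‖f‖ ^ (2 ^ k - 1))) := by ring
      _ = D * (C * ‖f‖) ^ (2 ^ k) := by rw [hexp, mul_pow]
  -- conclusion
  by_contra hlt
  push Not at hlt
  have hb0 : 0 ≤ C * ‖f‖ := by positivity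
  rcases hb0.eq_or_lt with hb | hb
  · have h0 := hpow 0
    rw [pow_zero, pow_one, pow_one, ← hb, mul_zero] at h0
    linarith [norm_nonneg (T f)]
  · set q : ℝ := ‖T f‖ / (C * ‖f‖) with hq
    have hq1 : 1 < q := by rw [hq, one_lt_div hb]; exact hlt
    have hqk : ∀ k, q ^ (2 ^ k) ≤ D := fun k => by
      rw [hq, div_pow, div_le_iff₀ (pow_pos hb _)]
      exact hpow k
    obtain ⟨N, hN⟩ := pow_unbounded_of_one_lt D hq1
    have hle : q ^ N ≤ q ^ (2 ^ N) := pow_le_pow_right₀ hq1.le Nat.lt_two_pow_self.le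
    linarith [hqk N]

end Literature.MathematicalPhysics.QuantumFieldTheory.Balaban1983to89.B9Eq347SupRowToL2Symmetric

end
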